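import Mathlib
import Literature.Computability.AlgebraicComplexity.PrattTrapezoidVal
import Summits.MatrixMultiplication.MatrixMultiplication.Theorems.EisensteinValCertificatesPrimeValSavingPointwiseLoads
import Summits.MatrixMultiplication.MatrixMultiplication.Theorems.EisensteinValCertificatesPrimeValSavingDisjointSquares
import Summits.MatrixMultiplication.MatrixMultiplication.Theorems.EisensteinValCertificatesPrimeValSavingValConstant

/-!
# A density threshold for trapezoid-free triples at prime modulus

Fifth support file of the series (`…PointwiseLoads`, `…DisjointSquares`, `…ValConstant`,
`…Dichotomy`) for route `MatrixMultiplication/EisensteinValCertificates`, cruxes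
`stmt-MatrixMultiplication-7788` `PrimeValSaving` and stmt-7790 `PrimeFourThirdsSaving` — the first
statement of the series that USES PRIMALITY (through Mathlib's Cauchy–Davenport theorem).

Notation: a *point* of `(A, B, C)` is a solution of `a + b + c = 0`; the load of the `C`-line `c` is
`r(c) = #{b ∈ B : -(b+c) ∈ A}` (the number of representations of `-c` in `A + B`).

* `card_sub_mul_le` (any finite abelian group): if every `c ∈ U` has load `≤ ρ` then
  `#(U - U)·(2#B + #A) ≤ #B² + #(U - U)·(|G| + 2ρ)` — `B` is almost invariant under `U - U`
  (`PrattValConstant.card_filter_notMem_add_le`) while `∑_d |B ∩ (B + d)| = #B²`.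
* `card_popular_mul_sq_le`: for a trapezoid-free triple, `#{c ∈ C : ρ < r(c)}·ρ² ≤ #A·#B`
  (disjoint squares, system 1).
* `min_mul_le_of_prime` (`p` prime, Cauchy–Davenport): with `U = {c ∈ C : r(c) ≤ ρ}` nonempty,
  `min p (2#U - 1)·(2#B + #A) ≤ #B² + min p (2#U - 1)·(p + 2ρ)`.
* **`five_mul_min_card_le`**: for `p` prime and every equilateral-trapezoid-free `(A, B, C)` in `ℤ/p`,
  `5·min(#A, #B, #C) ≤ 2p + 10ρ + 10⌊p²/ρ²⌋ + 10` for every `ρ ≥ 1`; with `ρ ≈ p^{2/3}`: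
  **`min(#A, #B, #C) ≤ (2/5)p + O(p^{2/3})`** (`min_card_le_of_prime`, the `∀ ε` form).
  So at prime modulus three sets of density `> 2/5 + o(1)` are never trapezoid-free, whereas
  density `1/3` is (vacuously: `A = B = C ⊂ (p/3, 2p/3)` has no points) and density `1/2` is in
  `ℤ/2m` (`A = B = C =` the odd residues).  Only system 1, counting and Cauchy–Davenport enter.
  Consequence for the constant of `PrattValConstant.prattVal_le_rpow` at primes: maximising `xyz`
  under these constraints gives `Val(ℤ/p) ≤ ((2/5)^{3/2} + o(1)) p^{3/2} ≈ 0.253 p^{3/2}` (finite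
  optimisation, not formalised here; `2^{-3/2} ≈ 0.354` holds in every abelian group).

[cite: Pratt2024, Def. 3.2, Prop. 3.1, Prop. 3.4]
-/

-- single-conjunct summit: the mandated namespace repeats `MatrixMultiplication`.
set_option linter.dupNamespace false

namespace Summit.MatrixMultiplication.MatrixMultiplication.Theorems

namespace PrattValPrimeDensity

open Finset Literature.Computability.AlgebraicComplexity PrattValPointwiseLoads PrattValDisjointSquares
  PrattValConstant
open scoped Pointwise

variable {G : Type*} [AddCommGroup G] [DecidableEq G] {A B C : Finset G}

/-! ### Counting: `∑_d |B ∩ (B + d)| = #B²` -/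

/-- `∑_{d ∈ G} #{b ∈ B : b - d ∈ B} = #B²` (count the pairs `(b, b - d) ∈ B × B`). [folklore] -/
theorem sum_card_filter_sub_mem [Fintype G] (B : Finset G) :
    ∑ d, #(B.filter fun b => b - d ∈ B) = #B ^ 2 := by
  calc ∑ d, #(B.filter fun b => b - d ∈ B)
      = ∑ d, ∑ b ∈ B, if b - d ∈ B then 1 else 0 := by
        refine sum_congr rfl fun d _ => ?_
        rw [card_filter]
    _ = ∑ b ∈ B, ∑ d, if b - d ∈ B then 1 else 0 := sum_comm
    _ = ∑ b ∈ B, #B := by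
        refine sum_congr rfl fun b _ => ?_
        rw [← card_filter]
        refine card_bij' (fun d _ => b - d) (fun b' _ => b - b') ?_ ?_ ?_ ?_
        · intro d hd; exact (mem_filter.1 hd).2
        · intro b' hb'
          refine mem_filter.2 ⟨mem_univ _, ?_⟩
          have : b - (b - b') = b' := by abel
          rw [this]; exact hb'
        · intro d _; abel
        · intro b' _; abel
    _ = #B ^ 2 := by rw [sum_const, smul_eq_mul, sq]

/-! ### Near-periodicity summed over a difference set -/

/-- **Almost-invariance of `B` under `U - U`.** If every `c ∈ U` has load `r(c) ≤ ρ`, then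
`#(U - U)·(2#B + #A) ≤ #B² + #(U - U)·(|G| + 2ρ)`: each `d ∈ U - U` satisfies
`|B ∩ (B + d)| ≥ 2#B + #A - |G| - 2ρ` (`card_filter_notMem_add_le`), and `∑_d |B ∩ (B+d)| = #B²`.
[folklore] -/
theorem card_sub_mul_le [Fintype G] (A B U : Finset G) (ρ : ℕ)
    (hU : ∀ c ∈ U, #(B.filter fun b => -(b + c) ∈ A) ≤ ρ) :
    #(U - U) * (2 * #B + #A) ≤ #B ^ 2 + #(U - U) * (Fintype.card G + 2 * ρ) := by
  -- pointwise bound for each `d ∈ U - U`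
  have hd : ∀ d ∈ U - U, 2 * #B + #A ≤ #(B.filter fun b => b - d ∈ B) + (Fintype.card G + 2 * ρ) := by
    intro d hd
    obtain ⟨c', hc', c, hc, rfl⟩ := mem_sub.1 hd
    have h1 := card_filter_notMem_add_le A B c c'
    have h2 : #(B.filter fun b => b - (c' - c) ∈ B) + #(B.filter fun b => b + c - c' ∉ B) = #B := by
      have := card_filter_add_card_filter_not (s := B) (fun b => b - (c' - c) ∈ B)
      rw [← this]
      congr 2
      ext b
      simp only [mem_filter]
      have : b - (c' - c) = b + c - c' := by abel
      rw [this]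
    have h3 := hU c hc
    have h4 := hU c' hc'
    omega
  calc #(U - U) * (2 * #B + #A) = ∑ d ∈ U - U, (2 * #B + #A) := by rw [sum_const, smul_eq_mul]
    _ ≤ ∑ d ∈ U - U, (#(B.filter fun b => b - d ∈ B) + (Fintype.card G + 2 * ρ)) := sum_le_sum hd
    _ = ∑ d ∈ U - U, #(B.filter fun b => b - d ∈ B) + #(U - U) * (Fintype.card G + 2 * ρ) := by
        rw [sum_add_distrib, sum_const, smul_eq_mul]
    _ ≤ ∑ d, #(B.filter fun b => b - d ∈ B) + #(U - U) * (Fintype.card G + 2 * ρ) :=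
        Nat.add_le_add_right (sum_le_sum_of_subset_of_nonneg (subset_univ _) fun _ _ _ => Nat.zero_le _) _
    _ = #B ^ 2 + #(U - U) * (Fintype.card G + 2 * ρ) := by rw [sum_card_filter_sub_mem]

/-! ### Popular lines are few -/

/-- For a trapezoid-free triple, the `C`-lines of load `> ρ` number at most `#A·#B/ρ²`
(disjoint squares, `sum_sq_C_le`). [cite: Pratt2024, Prop. 3.1] -/
theorem card_popular_mul_sq_le (h : IsEquilateralTrapezoidFree A B C) (ρ : ℕ) :
    #(C.filter fun c => ρ < #(A.filter fun a => -(a + c) ∈ B)) * ρ ^ 2 ≤ #A * #B := by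
  calc #(C.filter fun c => ρ < #(A.filter fun a => -(a + c) ∈ B)) * ρ ^ 2
      = ∑ c ∈ C.filter (fun c => ρ < #(A.filter fun a => -(a + c) ∈ B)), ρ ^ 2 := by
        rw [sum_const, smul_eq_mul]
    _ ≤ ∑ c ∈ C.filter (fun c => ρ < #(A.filter fun a => -(a + c) ∈ B)),
          #(A.filter fun a => -(a + c) ∈ B) ^ 2 :=
        sum_le_sum fun c hc => Nat.pow_le_pow_left (mem_filter.1 hc).2.le 2
    _ ≤ ∑ c ∈ C, #(A.filter fun a => -(a + c) ∈ B) ^ 2 :=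
        sum_le_sum_of_subset_of_nonneg (filter_subset _ _) fun _ _ _ => Nat.zero_le _
    _ ≤ #A * #B := sum_sq_C_le h

/-! ### Prime modulus: Cauchy–Davenport -/

/-- **Unpopular lines are few at prime modulus.** For `p` prime and a nonempty set `U` of elements
of load `≤ ρ`: `min p (2#U - 1)·(2#B + #A) ≤ #B² + min p (2#U - 1)·(p + 2ρ)`, by `card_sub_mul_le`
and Cauchy–Davenport (`#(U - U) ≥ min p (2#U - 1)`). [cite: Pratt2024, Def. 3.2; Cauchy–Davenport] -/
theorem min_mul_le_of_prime {p : ℕ} (hp : p.Prime) (A B U : Finset (ZMod p)) (ρ : ℕ)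
    (hne : U.Nonempty) (hU : ∀ c ∈ U, #(B.filter fun b => -(b + c) ∈ A) ≤ ρ) :
    min p (2 * #U - 1) * (2 * #B + #A) ≤ #B ^ 2 + min p (2 * #U - 1) * (p + 2 * ρ) := by
  haveI : Fact p.Prime := ⟨hp⟩
  have hcd : min p (2 * #U - 1) ≤ #(U - U) := by
    have h := ZMod.cauchy_davenport hp hne hne.neg
    rw [card_neg, ← sub_eq_add_neg] at h
    convert h using 2
    omega
  have hA := card_sub_mul_le A B U ρ hU
  rw [ZMod.card] at hA
  set μ := min p (2 * #U - 1) with hμ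
  set D := #(U - U) with hD
  by_cases hcase : 2 * #B + #A ≤ p + 2 * ρ
  · calc μ * (2 * #B + #A) ≤ μ * (p + 2 * ρ) := Nat.mul_le_mul_left _ hcase
      _ ≤ #B ^ 2 + μ * (p + 2 * ρ) := Nat.le_add_left _ _
  · rw [not_le] at hcase
    -- `D · X ≤ #B²` with `X = (2#B + #A) - (p + 2ρ)`, and `μ ≤ D`
    have hX : D * ((2 * #B + #A) - (p + 2 * ρ)) ≤ #B ^ 2 := by
      rw [Nat.mul_sub]
      omega
    have hμX : μ * ((2 * #B + #A) - (p + 2 * ρ)) ≤ #B ^ 2 :=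
      (Nat.mul_le_mul_right _ hcd).trans hX
    rw [Nat.mul_sub] at hμX
    have : μ * (p + 2 * ρ) ≤ μ * (2 * #B + #A) := Nat.mul_le_mul_left _ hcase.le
    omega

/-! ### The density threshold `2/5` -/

/-- Arithmetic core of `five_mul_min_card_le`: the quadratic `b ↦ b² - ν(2b + m - p - 2ρ)` is
negative at `b = m` and at `b = p` under the stated size hypotheses, hence (convexity) on all of
`[m, p]`. [folklore] -/
theorem quad_contra (ν b m p ρ q : ℤ) (hν : 2*m - 2*q - 1 ≤ ν) (hmb : m ≤ b) (hbp : b ≤ p)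
    (hp : 2 ≤ p) (hρ : 1 ≤ ρ) (hq : 0 ≤ q) (hcon : 2*p + 10*ρ + 10*q + 10 < 5*m)
    (H1 : ν * (2*b + m) ≤ b^2 + ν*(p + 2*ρ)) : False := by
  have hm2 : 2*q + 2*ρ + 2 < m := by linarith
  have hm0 : 0 < m := by linarith
  have hν0 : 0 < ν := by linarith
  have E1 : 0 < 3*m - p - 2*ρ := by linarith
  have E2 : 0 < p + m - 2*ρ := by linarith
  -- g(m) < 0
  have G1 : m^2 < ν * (3*m - p - 2*ρ) := by
    have h1 : (2*m - 2*q - 1) * (3*m - p - 2*ρ) ≤ ν * (3*m - p - 2*ρ) :=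
      mul_le_mul_of_nonneg_right hν E1.le
    have h3 : m + 6*ρ + 10*q + 10 < 2 * (3*m - p - 2*ρ) := by linarith
    have h4 : 0 < 2*m - 2*q - 1 := by linarith
    have h5 : (2*m - 2*q - 1) * (m + 6*ρ + 10*q + 10) < (2*m-2*q-1) * (2*(3*m - p - 2*ρ)) :=
      mul_lt_mul_of_pos_left h3 h4
    have h6 : 2 * m^2 ≤ (2*m - 2*q - 1) * (m + 6*ρ + 10*q + 10) := by
      have hmρ : (2*q + 2*ρ + 2) * ρ ≤ m * ρ := mul_le_mul_of_nonneg_right hm2.le (by linarith)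
      have hmq : (2*q + 2*ρ + 2) * q ≤ m * q := mul_le_mul_of_nonneg_right hm2.le hq
      nlinarith [mul_nonneg hq (by linarith : (0:ℤ) ≤ ρ), mul_nonneg hq hq, sq_nonneg ρ]
    nlinarith
  -- g(p) < 0
  have G2 : p^2 < ν * (p + m - 2*ρ) := by
    have h1 : (2*m - 2*q - 1) * (p + m - 2*ρ) ≤ ν * (p + m - 2*ρ) :=
      mul_le_mul_of_nonneg_right hν E2.le
    have h3 : 4*p ≤ 5*(2*m - 2*q - 1) := by linarith
    have h4 : 7*p ≤ 5*(p + m - 2*ρ) := by linarith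
    have h5 : 28 * p^2 ≤ 25 * ((2*m - 2*q - 1) * (p + m - 2*ρ)) := by
      have := mul_le_mul h3 h4 (by linarith) (by linarith)
      nlinarith
    nlinarith
  -- convexity on [m, p]
  have key : (p - m) * (b^2 - ν*(2*b + m - p - 2*ρ)) =
      (p - b) * (m^2 - ν*(3*m - p - 2*ρ)) + (b - m) * (p^2 - ν*(p + m - 2*ρ)) +
      (p - m) * ((b - m) * (b - p)) := by ring
  have f0 : 0 ≤ b^2 - ν*(2*b + m - p - 2*ρ) := by linarith
  have t4 : 0 ≤ (p - m) * (b^2 - ν*(2*b + m - p - 2*ρ)) := mul_nonneg (by linarith) f0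
  have t1 : 0 ≤ (p - b) * (ν*(3*m-p-2*ρ) - m^2) := mul_nonneg (by linarith) (by linarith)
  have t2 : 0 ≤ (b - m) * (ν*(p+m-2*ρ) - p^2) := mul_nonneg (by linarith) (by linarith)
  have t3 : 0 ≤ (p - m) * ((b - m) * (p - b)) :=
    mul_nonneg (by linarith) (mul_nonneg (by linarith) (by linarith))
  rcases lt_or_eq_of_le hbp with hlt | heq
  · have t1' : 0 < (p - b) * (ν*(3*m-p-2*ρ) - m^2) := mul_pos (by linarith) (by linarith)
    nlinarith
  · subst heq
    have t2' : 0 < (b - m) * (ν*(b+m-2*ρ) - b^2) := by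
      rcases lt_or_eq_of_le hmb with hlt2 | heq2
      · exact mul_pos (by linarith) (by linarith)
      · subst heq2; linarith
    nlinarith


/-- **Density threshold at prime modulus (explicit form).** For `p` prime, every
equilateral-trapezoid-free triple `(A, B, C)` in `ℤ/p` and every `ρ ≥ 1`:
`5·min(#A, #B, #C) ≤ 2p + 10ρ + 10⌊p²/ρ²⌋ + 10`.  [cite: Pratt2024, Def. 3.2] -/
theorem five_mul_min_card_le {p : ℕ} (hp : p.Prime) {A B C : Finset (ZMod p)}
    (h : IsEquilateralTrapezoidFree A B C) (ρ : ℕ) (hρ : 1 ≤ ρ) :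
    5 * min (min #A #B) #C ≤ 2 * p + 10 * ρ + 10 * (p ^ 2 / ρ ^ 2) + 10 := by
  haveI : Fact p.Prime := ⟨hp⟩
  set m := min (min #A #B) #C with hm
  have hmA : m ≤ #A := (min_le_left _ _).trans (min_le_left _ _)
  have hmB : m ≤ #B := (min_le_left _ _).trans (min_le_right _ _)
  have hmC : m ≤ #C := min_le_right _ _
  have hAp : #A ≤ p := (card_le_univ _).trans (ZMod.card p).le
  have hBp : #B ≤ p := (card_le_univ _).trans (ZMod.card p).le
  have hCp : #C ≤ p := (card_le_univ _).trans (ZMod.card p).le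
  -- split `C` into unpopular (`U`) and popular (`P`) lines
  set U := C.filter (fun c => #(B.filter fun b => -(b + c) ∈ A) ≤ ρ) with hUdef
  set P := C.filter (fun c => ρ < #(A.filter fun a => -(a + c) ∈ B)) with hPdef
  have hsplit : #U + #P = #C := by
    rw [hUdef, hPdef, ← card_filter_add_card_filter_not (s := C)
      (fun c => #(B.filter fun b => -(b + c) ∈ A) ≤ ρ)]
    congr 2
    ext c
    simp only [mem_filter, not_le, card_A_through_C_eq]
  have hP : #P ≤ p ^ 2 / ρ ^ 2 := by
    rw [Nat.le_div_iff_mul_le (by positivity)]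
    calc #P * ρ ^ 2 ≤ #A * #B := card_popular_mul_sq_le h ρ
      _ ≤ p * p := Nat.mul_le_mul hAp hBp
      _ = p ^ 2 := (sq p).symm
  set q := p ^ 2 / ρ ^ 2 with hq
  clear_value q m
  by_contra hcon
  rw [not_le] at hcon
  -- so `m` is large; in particular `U` is nonempty
  have hUne : U.Nonempty := by
    rw [← card_pos]
    omega
  have hU : ∀ c ∈ U, #(B.filter fun b => -(b + c) ∈ A) ≤ ρ := fun c hc => (mem_filter.1 hc).2
  have key := min_mul_le_of_prime hp A B U ρ hUne hU
  have hmAZ : (m : ℤ) ≤ #A := by exact_mod_cast hmA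
  have hmBZ : (m : ℤ) ≤ #B := by exact_mod_cast hmB
  have hBpZ : (#B : ℤ) ≤ p := by exact_mod_cast hBp
  have hconZ : 2 * (p : ℤ) + 10 * ρ + 10 * q + 10 < 5 * m := by exact_mod_cast hcon
  have hp2 : (2 : ℤ) ≤ p := by exact_mod_cast hp.two_le
  have hρZ : (1 : ℤ) ≤ ρ := by exact_mod_cast hρ
  have hqZ : (0 : ℤ) ≤ q := by exact_mod_cast Nat.zero_le q
  -- case analysis on the `min`
  rcases le_total p (2 * #U - 1) with hle | hle
  · rw [min_eq_left hle] at key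
    -- `p (2b + a) ≤ b² + p (p + 2ρ)` is impossible for `a, b ≥ m > 2p/5 + 2ρ`, `b ≤ p`
    have keyZ : (p : ℤ) * (2 * #B + #A) ≤ (#B : ℤ) ^ 2 + p * (p + 2 * ρ) := by exact_mod_cast key
    have step : (p : ℤ) * (2 * #B + m) ≤ (p : ℤ) * (2 * #B + #A) :=
      mul_le_mul_of_nonneg_left (by linarith) (by linarith)
    nlinarith [keyZ, step, hmBZ, hBpZ, hconZ, hρZ, hqZ, sq_nonneg ((p : ℤ) - #B)]
  · rw [min_eq_right hle] at key
    have hu : m ≤ #U + q := by omega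
    have hU1 : 1 ≤ #U := card_pos.2 hUne
    have keyZ : ((2 * #U - 1 : ℕ) : ℤ) * (2 * #B + #A) ≤
        (#B : ℤ) ^ 2 + ((2 * #U - 1 : ℕ) : ℤ) * (p + 2 * ρ) := by
      exact_mod_cast key
    have hcast : ((2 * #U - 1 : ℕ) : ℤ) = 2 * (#U : ℤ) - 1 := by
      rw [Nat.cast_sub (by omega)]; push_cast; ring
    rw [hcast] at keyZ
    have hν0 : (0 : ℤ) < 2 * (#U : ℤ) - 1 := by
      have : (1 : ℤ) ≤ #U := by exact_mod_cast hU1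
      linarith
    have hν_ge : 2 * (m : ℤ) - 2 * q - 1 ≤ 2 * (#U : ℤ) - 1 := by
      have : (m : ℤ) ≤ #U + q := by exact_mod_cast hu
      linarith
    have H1 : (2 * (#U : ℤ) - 1) * (2 * #B + m) ≤
        (#B : ℤ) ^ 2 + (2 * (#U : ℤ) - 1) * (p + 2 * ρ) := by
      have step : (2 * (#U : ℤ) - 1) * (2 * #B + m) ≤ (2 * (#U : ℤ) - 1) * (2 * #B + #A) :=
        mul_le_mul_of_nonneg_left (by linarith) hν0.le
      linarith
    -- quadratic in `b = #B` on `[m, p]`: negative at both ends, convex ⇒ contradiction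
    exact quad_contra _ _ _ _ _ _ hν_ge hmBZ hBpZ hp2 hρZ hqZ hconZ H1


/-- **Density threshold at prime modulus (`∀ ε` form).** For every `ε > 0` and all sufficiently large
primes `p`, every equilateral-trapezoid-free triple `(A, B, C)` in `ℤ/p` has
`min(#A, #B, #C) ≤ (2/5 + ε)·p`.  (Density `1/3` is attained vacuously by
`A = B = C ⊂ (p/3, 2p/3)`, which has no points; in `ℤ/2m` the odd residues give density `1/2`.)
[cite: Pratt2024, Def. 3.2] -/
theorem min_card_le_of_prime (ε : ℝ) (hε : 0 < ε) :
    ∃ p₀ : ℕ, ∀ p : ℕ, p₀ ≤ p → p.Prime → ∀ A B C : Finset (ZMod p),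
      IsEquilateralTrapezoidFree A B C → ((min (min #A #B) #C : ℕ) : ℝ) ≤ (2 / 5 + ε) * p := by
  refine ⟨⌈256 / ε ^ 3 + 8 / ε⌉₊ + 1, fun p hp0 hp A B C h => ?_⟩
  have hpR : (256 / ε ^ 3 + 8 / ε : ℝ) < p := by
    have h1 := Nat.le_ceil (256 / ε ^ 3 + 8 / ε)
    have h2 : ((⌈256 / ε ^ 3 + 8 / ε⌉₊ + 1 : ℕ) : ℝ) ≤ p := by exact_mod_cast hp0
    push_cast at h2
    linarith
  have hpos1 : (0 : ℝ) ≤ 256 / ε ^ 3 := by positivity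
  have hpos2 : (0 : ℝ) ≤ 8 / ε := by positivity
  have hp8 : 8 / ε ≤ (p : ℝ) := by linarith
  set ρ : ℕ := ⌊ε * p / 4⌋₊ with hρdef
  have hρle : (ρ : ℝ) ≤ ε * p / 4 := Nat.floor_le (by positivity)
  have hρge : ε * p / 4 - 1 ≤ ρ := by
    have := Nat.lt_floor_add_one (ε * p / 4)
    linarith
  have hεp : 8 ≤ ε * p := by
    have h1 : ε * (8 / ε) ≤ ε * p := mul_le_mul_of_nonneg_left hp8 hε.le
    have h2 : ε * (8 / ε) = 8 := by field_simp
    linarith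
  have hρ1R : (1 : ℝ) ≤ ρ := by linarith
  have hρ1 : 1 ≤ ρ := by exact_mod_cast hρ1R
  have main := five_mul_min_card_le hp h ρ hρ1
  have mainR : (5 : ℝ) * ((min (min #A #B) #C : ℕ) : ℝ) ≤
      2 * p + 10 * ρ + 10 * ((p ^ 2 / ρ ^ 2 : ℕ) : ℝ) + 10 := by
    exact_mod_cast main
  have hdiv : ((p ^ 2 / ρ ^ 2 : ℕ) : ℝ) ≤ ((p ^ 2 : ℕ) : ℝ) / ((ρ ^ 2 : ℕ) : ℝ) := Nat.cast_div_le
  have hρ8 : ε * p / 8 ≤ ρ := by linarith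
  have hρpos : (0 : ℝ) < ρ := by linarith
  have hfrac : ((p ^ 2 : ℕ) : ℝ) / ((ρ ^ 2 : ℕ) : ℝ) ≤ 64 / ε ^ 2 := by
    push_cast
    rw [div_le_div_iff₀ (by positivity) (by positivity)]
    have h1 : ε * p ≤ 8 * ρ := by linarith
    have h2 : 0 ≤ ε * p := by positivity
    nlinarith [mul_le_mul h1 h1 h2 (by positivity)]
  have e3 : 640 / ε ^ 2 + 10 ≤ 5 / 2 * (ε * p) := by
    have h1 : ε * (256 / ε ^ 3 + 8 / ε) < ε * p := mul_lt_mul_of_pos_left hpR hε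
    have h2 : ε * (256 / ε ^ 3 + 8 / ε) = 256 / ε ^ 2 + 8 := by
      field_simp
    have h3 : 256 / ε ^ 2 + 8 < ε * p := by rw [← h2]; exact h1
    have h4 : (640 : ℝ) / ε ^ 2 = 5 / 2 * (256 / ε ^ 2) := by ring
    rw [h4]
    linarith
  have hX : ((p ^ 2 / ρ ^ 2 : ℕ) : ℝ) ≤ 64 / ε ^ 2 := hdiv.trans hfrac
  have hρ10 : 10 * (ρ : ℝ) ≤ 5 / 2 * (ε * p) := by linarith
  have h5 : (5 : ℝ) * ((min (min #A #B) #C : ℕ) : ℝ) ≤ 2 * p + 5 * (ε * p) := by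
    have h6 : (2 : ℝ) * p + 10 * ρ + 10 * ((p ^ 2 / ρ ^ 2 : ℕ) : ℝ) + 10 ≤ 2 * p + 5 * (ε * p) := by
      have h7 : 10 * ((p ^ 2 / ρ ^ 2 : ℕ) : ℝ) ≤ 10 * (64 / ε ^ 2) :=
        mul_le_mul_of_nonneg_left hX (by norm_num)
      have h7' : (10 : ℝ) * (64 / ε ^ 2) = 640 / ε ^ 2 := by ring
      rw [h7'] at h7
      linarith
    exact mainR.trans h6
  have h8 : (2 / 5 + ε) * (p : ℝ) = (2 * p + 5 * (ε * p)) / 5 := by ring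
  rw [h8, le_div_iff₀ (by norm_num)]
  linarith

end PrattValPrimeDensity


end Summit.MatrixMultiplication.MatrixMultiplication.Theorems
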